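import Summits.NavierStokesRegularity.NavierStokesRegularity.Theorems.ThreadingFluxCentreVirialFluxProfile
import HarnessLib

/-!
# Crux `PoloidalLiouville` (stmt-NavierStokesRegularity-1222, W1), crux idea «centre-virial» (ns-idea-15 g9):
# ★ (T1) RADIAL-DOMINANCE LIOUVILLE — UNCONDITIONAL; (T2) poloidal tameness Liouville modulo Hodge slaving

* `radialDominanceLiouville : RadialDominanceLiouville` (T1, by name over the twin `ThreadingFluxCentreVirialDefs`): for every
  Leray–Galdi `D`-solution `(u, p)` of steady Navier–Stokes on `ℝ³` and EVERY centre `x₀`, if on every far shell the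
  `r⁻³`-weighted tangential kinetic energy is at most twice the radial one then `u ≡ 0`; contrapositive portrait: a
  non-trivial `D`-solution is tangentially dominated at infinity about every centre.  = the card's K5 (`radialDominanceLiouville_of_fluxProfile`,
  proof verbatim from the sketch, planner ns-idea-15 g9) applied to the unconditional flux profile `fluxProfile`.
* `poloidalTameLiouville_of_hodge : HodgeSlavingShell → PoloidalTameLiouville` (T2 modulo H; K4 of the card re-checked over
  the Theorems-side names as `poloidalTameLiouville_of`); H (Hodge decomposition + sharp Poincaré on spheres) stays OPEN in
  the tree (size L).
* bookkeeping K0/K1: `steadyPoloidalDLiouville_of_galdi`, `wallOnSteadyDecayingStratum_of` (implications between OPEN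
  statements; no credit).

Booking (V25-P3): information-grade portrait theorems on the steady decaying stratum of W1; W1 movement 0; T0
`SteadyPoloidalDLiouville`, `PoloidalLiouville` (1222) and Galdi's Liouville problem stay OPEN; NS regularity is NOT proved.
`--supports stmt-NavierStokesRegularity-1222 --as helper`.  Filed by ns-wall-eng-4 g6 (cell ns-wall-extremal).
[cite: KorobkovPileckasRusso2015, Thm 3.6]
-/

-- the summit and its single sub-problem share the name (CONVENTIONS §1)
set_option linter.dupNamespace false

noncomputable section

namespace Summit.NavierStokesRegularity.NavierStokesRegularity.Theorems.PoloidalLiouville.CentreVirial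

open Set Function MeasureTheory Filter Topology
open Literature.Analysis.FluidPDE
open Literature.Analysis.FluidPDE.VectorCalculus (divergence IsDivFree)
open Summit.NavierStokesRegularity.NavierStokesRegularity.Theorems.PoloidalLiouville.CentreJet
  (E3 IsUnthreadedAbout IsSteadyNSOn)
open scoped RealInnerProductSpace

/-- (K5 of the card, re-checked over the Theorems-side names) **T1 ⇐ B.**  Radial dominance on the far shells makes the
flux profile `G` non-increasing on `[t₀, ∞)`; with `G → 0` this gives `G ≥ 0` there; the ball inequality then forces
`∫_{B_t}|u|² ≤ 0` for every `t ≥ t₀`, and continuity gives `u ≡ 0` (every point lies in some such ball — no unique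
continuation).  Proof verbatim from the sketch (planner ns-idea-15 g9), credited. -/
theorem radialDominanceLiouville_of_fluxProfile (hB : FluxProfile) : RadialDominanceLiouville := by
  intro u p x₀ t₀ hD ht₀ hShell x
  obtain ⟨G, hBall, hDiff, hLim⟩ := hB u p x₀ hD
  -- `G` is non-increasing beyond `t₀`
  have hAnti : ∀ a b : ℝ, t₀ ≤ a → a ≤ b → G b ≤ G a := by
    intro a b ha hab
    rcases eq_or_lt_of_le hab with h | h
    · rw [h]
    · have h1 := hDiff a b (lt_of_lt_of_le ht₀ ha) h
      have h2 := hShell a b ha h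
      linarith
  -- hence nonnegative beyond `t₀`
  have hGnn : ∀ a : ℝ, t₀ ≤ a → 0 ≤ G a := fun a ha =>
    le_of_tendsto hLim (Filter.eventually_atTop.2 ⟨a, fun b hb => hAnti a b ha hb⟩)
  by_contra hx
  set t : ℝ := max t₀ (‖x - x₀‖ + 1) with ht_def
  have htpos : 0 < t := lt_of_lt_of_le ht₀ (le_max_left _ _)
  have hxt : x ∈ Metric.ball x₀ t := by
    rw [Metric.mem_ball, dist_eq_norm]
    exact lt_of_lt_of_le (lt_add_one _) (le_max_right _ _)
  have hle : ∫ z in Metric.ball x₀ t, ‖u z‖ ^ 2 ≤ 0 := by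
    have h1 := hBall t htpos
    have h2 : 0 ≤ t ^ 3 * G t := mul_nonneg (pow_nonneg htpos.le 3) (hGnn t (le_max_left _ _))
    linarith
  have hcont : Continuous fun z => ‖u z‖ ^ 2 :=
    (continuous_norm.comp (contDiffOn_univ.mp hD.1.1).continuous).pow 2
  have hint : IntegrableOn (fun z => ‖u z‖ ^ 2) (Metric.ball x₀ t) volume :=
    (hcont.continuousOn.integrableOn_compact (isCompact_closedBall x₀ t)).mono_set Metric.ball_subset_closedBall
  have hpos : 0 < ∫ z in Metric.ball x₀ t, ‖u z‖ ^ 2 := by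
    rw [setIntegral_pos_iff_support_of_nonneg_ae (Eventually.of_forall fun z => sq_nonneg ‖u z‖) hint]
    have hopen : IsOpen (Function.support (fun z => ‖u z‖ ^ 2) ∩ Metric.ball x₀ t) :=
      (isOpen_ne_fun hcont continuous_const).inter Metric.isOpen_ball
    exact hopen.measure_pos volume ⟨x, pow_ne_zero 2 (norm_ne_zero_iff.2 hx), hxt⟩
  linarith

/-- ★ **(T1) `RadialDominanceLiouville` — UNCONDITIONAL.**  For every Leray–Galdi `D`-solution `(u, p)` of the steady
Navier–Stokes system on `ℝ³` (classical, `∫|∇u|² < ∞`, `u → 0` at infinity) and EVERY centre `x₀`: if on every far shell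
`t₀ ≤ a < |x − x₀| < b` the `r⁻³`-weighted tangential kinetic energy is at most twice the radial one,
`∫ r⁻³|u_tan|² ≤ 2∫ r⁻³u_r²`, then `u ≡ 0`.  Contrapositive PORTRAIT: a non-trivial `D`-solution is tangentially dominated at
infinity about every centre.  Assembled from the flux profile (B, `fluxProfile`: V1 + the ball/shell Gauss–Green identity + the
tree's pressure limit F1 and head maximum principle F2) and the card's real-analysis step K5.  Information-grade
portrait theorem on the steady decaying stratum of W1 (booking V25-P3); `PoloidalLiouville` (1222), T0 and Galdi's Liouville problem
stay OPEN; NS regularity is NOT proved. [cite: KorobkovPileckasRusso2015, Thm 3.6] -/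
theorem radialDominanceLiouville : RadialDominanceLiouville :=
  radialDominanceLiouville_of_fluxProfile fluxProfile

/-- The shell is `ball b ∖ closedBall a`, hence measurable. -/
theorem measurableSet_shell (x₀ : E3) (a b : ℝ) : MeasurableSet (shell x₀ a b) := by
  have : shell x₀ a b = Metric.ball x₀ b \ Metric.closedBall x₀ a := by
    ext x
    simp only [shell, Set.mem_setOf_eq, Set.mem_sdiff, Metric.mem_ball, Metric.mem_closedBall, dist_eq_norm, not_le]
    tauto
  rw [this]
  exact Metric.isOpen_ball.measurableSet.diff Metric.isClosed_closedBall.measurableSet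

/-- (K4 of the card, re-checked over the Theorems-side names) **T2 ⇐ T1 + H.**  On every far shell tameness gives
`½ (∂_r(r²u_r))² ≤ 2 m²`, hence with Hodge slaving `∫ r⁻³|u_tan|² ≤ 2 ∫ r⁻³ u_r²`, and T1 applies.  Proof adapted from the
sketch (planner ns-idea-15 g9), credited. -/
theorem poloidalTameLiouville_of (hT1 : RadialDominanceLiouville) (hH : HodgeSlavingShell) :
    PoloidalTameLiouville := by
  intro u p x₀ t₀ hD hU ht₀ htame
  refine hT1 u p x₀ t₀ hD ht₀ ?_
  intro a b ha hab
  have ha0 : 0 < a := lt_of_lt_of_le ht₀ ha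
  have hC1 : ContDiff ℝ 1 u := (contDiffOn_univ.mp hD.1.1).of_le (by norm_num)
  have hdiv : IsDivFree u := fun x => hD.1.2.2.1 x (mem_univ x)
  have hS := hH u x₀ a b hC1 hdiv hU ha0 hab
  have huc : Continuous u := hC1.continuous
  have hm : ContDiff ℝ 1 (mom x₀ u) := (contDiff_id.sub contDiff_const).inner ℝ hC1
  have hmc : Continuous (mom x₀ u) := hm.continuous
  have hDc : Continuous (radialFluxDeriv x₀ u) := by
    unfold radialFluxDeriv
    exact hmc.add ((hm.continuous_fderiv one_ne_zero).clm_apply (continuous_id.sub continuous_const))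
  have hcn : ContinuousOn (fun x : E3 => ‖x - x₀‖) (Metric.closedBall x₀ b \ Metric.ball x₀ a) :=
    (continuous_norm.comp (continuous_id.sub continuous_const)).continuousOn
  have hr0 : ∀ x ∈ Metric.closedBall x₀ b \ Metric.ball x₀ a, ‖x - x₀‖ ^ 5 ≠ 0 := by
    intro x hx
    simp only [Set.mem_sdiff, Metric.mem_ball, dist_eq_norm, not_lt] at hx
    exact pow_ne_zero 5 (ha0.trans_le hx.2).ne'
  have hI1 : IntegrableOn (fun x => radialFluxDeriv x₀ u x ^ 2 / ‖x - x₀‖ ^ 5) (shell x₀ a b) volume :=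
    (integrableOn_of_continuousOn_closedShell ((hDc.pow 2).continuousOn.div (hcn.pow 5) hr0)).2
  have hI2 : IntegrableOn (fun x => 4 * radDensity x₀ u x) (shell x₀ a b) volume := by
    refine (integrableOn_of_continuousOn_closedShell (x₀ := x₀) (a := a) (b := b) ?_).2
    unfold radDensity
    exact continuousOn_const.mul ((hmc.pow 2).continuousOn.div (hcn.pow 5) hr0)
  have hpt : ∀ x ∈ shell x₀ a b, radialFluxDeriv x₀ u x ^ 2 / ‖x - x₀‖ ^ 5 ≤ 4 * radDensity x₀ u x := by
    intro x hx
    simp only [shell, Set.mem_setOf_eq] at hx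
    have hr : 0 < ‖x - x₀‖ := lt_trans ha0 hx.1
    have h5 : 0 < ‖x - x₀‖ ^ 5 := by positivity
    have htx := htame x (le_trans ha hx.1.le)
    have hsq : radialFluxDeriv x₀ u x ^ 2 ≤ 4 * mom x₀ u x ^ 2 := by
      have h0 : 0 ≤ |radialFluxDeriv x₀ u x| := abs_nonneg _
      have h1 : |radialFluxDeriv x₀ u x| ^ 2 ≤ (2 * |mom x₀ u x|) ^ 2 := pow_le_pow_left₀ h0 htx 2
      have h2 : |radialFluxDeriv x₀ u x| ^ 2 = radialFluxDeriv x₀ u x ^ 2 := sq_abs _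
      have h3 : |mom x₀ u x| ^ 2 = mom x₀ u x ^ 2 := sq_abs _
      nlinarith [h1, h2, h3]
    unfold radDensity
    rw [mul_div_assoc']
    exact div_le_div_of_nonneg_right hsq h5.le
  have hmono := setIntegral_mono_on hI1 hI2 (measurableSet_shell x₀ a b) hpt
  have h4 : ∫ x in shell x₀ a b, 4 * radDensity x₀ u x = 4 * ∫ x in shell x₀ a b, radDensity x₀ u x :=
    integral_const_mul 4 _
  calc ∫ x in shell x₀ a b, tanDensity x₀ u x
      ≤ (1 / 2) * ∫ x in shell x₀ a b, radialFluxDeriv x₀ u x ^ 2 / ‖x - x₀‖ ^ 5 := hS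
    _ ≤ (1 / 2) * ∫ x in shell x₀ a b, 4 * radDensity x₀ u x := mul_le_mul_of_nonneg_left hmono (by norm_num)
    _ = 2 * ∫ x in shell x₀ a b, radDensity x₀ u x := by rw [h4]; ring

/-- **(T2) `PoloidalTameLiouville` modulo Hodge slaving (H)** — the only remaining input of the card's poloidal theorem is
the sphere-wise Hodge/Poincaré inequality `HodgeSlavingShell` (`H¹_dR(S²) = 0`, sharp `λ₁(S_r) = 2/r²`; size L, not in
Mathlib); T1 is now a tree theorem.  Conditional (hypothesis `HodgeSlavingShell`), information-grade. -/
theorem poloidalTameLiouville_of_hodge (hH : HodgeSlavingShell) : PoloidalTameLiouville :=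
  poloidalTameLiouville_of radialDominanceLiouville hH

/-- (K0, bookkeeping) T0 is the poloidal sector of Galdi's Liouville conjecture — both OPEN; recorded as an implication. -/
theorem steadyPoloidalDLiouville_of_galdi (h : SteadyDLiouville) : SteadyPoloidalDLiouville :=
  fun u p _ hD _ => h u p hD

/-- (K1, bookkeeping) T0 would settle the wall's conclusion on the steady decaying stratum (`u ≡ 0 ⇒ curl u ≡ 0`). -/
theorem wallOnSteadyDecayingStratum_of (h : SteadyPoloidalDLiouville) : WallOnSteadyDecayingStratum := by
  intro u p x₀ hD hU x
  have hu : u = fun _ => (0 : E3) := funext (h u p x₀ hD hU)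
  rw [hu, curl_eq_curlCLM, fderiv_const_apply, map_zero]

end Summit.NavierStokesRegularity.NavierStokesRegularity.Theorems.PoloidalLiouville.CentreVirial
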